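import Literature.Topology.FourManifolds.ComplexProjectiveSpaceCellExtension
import Literature.Topology.FourManifolds.ComplexProjectiveSpaceCircleBundle
import Literature.Topology.FourManifolds.ComplexProjectiveSpaceProofs
import Literature.AlgebraicTopology.Homotopy.SphereMapRealization
import Literature.AlgebraicTopology.Homotopy.ConnectedMapHomology
import HarnessLib

/-!
# The comparison map `ℂℙᴺ → K(ℤ, 2)` is `(2N+1)`-connected

Topic `Literature/Topology/FourManifolds` (home of the tree's `ComplexProjectiveSpace n`).
A. Hatcher, *Algebraic Topology* (2002), §4.2, Example 4.50 ("`ℂP^∞` is a `K(ℤ, 2)`": the long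
exact sequence of `S¹ → S²ⁿ⁺¹ → ℂPⁿ` gives `π₂(ℂPⁿ) ≅ ℤ` and `πᵢ(ℂPⁿ) = 0` for `3 ≤ i ≤ 2n`)
together with the uniqueness argument of §4.3, Prop. 4.30 / Thm. 4.58 ("a map `f : X → Y`
inducing an isomorphism on `πₙ` … where `X` is built from an `n`-sphere by attaching cells of
dimension `> n` to kill higher homotopy, extends cell by cell since `πᵢ(Y) = 0` for `i > n`") and
Whitehead's theorem in the form of Spanier, *Algebraic Topology* (1966), Ch. 7 §5 Thm. 9. For the
FINITE skeleta `ℂPᴺ` this reads: **for every space `K` with `π₂(K) ≅ ℤ` and `πᵢ(K) = 0` for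
`i ≠ 2` (path connected, simply connected) and every `N ≥ 1` there is a `(2N+1)`-connected map
`c : ℂPᴺ → K`** — hence (Spanier 7.5.9, `ConnectedMapHomology.lean`) `c^* : Hⁱ(K; M) ≅ Hⁱ(ℂPᴺ; M)`
for `i ≤ 2N` (`c^*` a ring map, so the cohomology RING of a `K(ℤ, 2)` is a polynomial ring on a
degree-`2` generator in every finite range of degrees, by the tree's ring `H*(ℂPᴺ)`).

PROVED here (no definitions, no named facts), from the tree's bricks: realisation of a generator
of `π₂(K)` by a sphere map `S² → K` (`exists_sphereMap_mem_range`, `SphereMapRealization.lean`),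
`ℂP¹ ≅ S²` (`nonempty_diffeomorph_complexProjectiveSpace_one_sphere_holds`), cell-by-cell extension
over `ℂP¹ ⊂ ℂP² ⊂ ⋯ ⊂ ℂPᴺ` (`exists_extension_iterHyperplaneEmb`,
`ComplexProjectiveSpaceCellExtension.lean`, using `π_odd(K) = 0`), the homotopy groups of `ℂPᴺ`
(`ComplexProjectiveSpaceCircleBundle.lean`: `π₂ ≅ ℤ`, `πᵢ = 0` for `3 ≤ i ≤ 2N`, simply connected)
and the algebraic fact that an epimorphism between infinite cyclic groups is an isomorphism:

* `ComplexProjectiveSpace.injective_of_surjective_of_mulEquiv_int` — a surjective homomorphism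
  between groups isomorphic to `ℤ` is injective;
* **`ComplexProjectiveSpace.exists_connected_comparison`** — the `(2N+1)`-connected
  `c : ℂP¹⁺ᵏ → K` (`N = 1 + k`), with its base point `x₁`, `c x₁ = k₀`: `c_*` onto on `π_{j+1}` for
  `j + 1 ≤ 2N + 1` and one-to-one on `π_{j+1}` for `j + 2 ≤ 2N + 1`;
* **`ComplexProjectiveSpace.exists_comparison_isIso_singularCohomology`** — the consequence
  `c^* : Hⁱ(K; M) ≅ Hⁱ(ℂP¹⁺ᵏ; M)` for `i ≤ 2(1+k)`, `R` a principal ideal domain, `M` an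
  `R`-module, and `c_* : Hᵢ(ℂP¹⁺ᵏ; R) ≅ Hᵢ(K; R)` for `i ≤ 2(1+k)`, any commutative ring `R`.

## References

* A. Hatcher, *Algebraic Topology*, CUP (2002), §4.2 Example 4.50; §4.3 Prop. 4.30, Thm. 4.58,
  Lemma 4.7; §4.1 p. 346. [HatcherAT2002]
* E. H. Spanier, *Algebraic Topology* (1966), Ch. 7 §5 Thm. 9. [Spanier1981]
-/

noncomputable section

open Set Metric Function Topology CategoryTheory
open scoped unitInterval Topology Manifold

namespace Literature.Topology.FourManifolds

open Literature.AlgebraicTopology.Homotopy Literature.AlgebraicTopology.SingularHomology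

namespace ComplexProjectiveSpace

/-! ### Epimorphisms of infinite cyclic groups are isomorphisms -/

/-- **A surjective homomorphism between groups isomorphic to `ℤ` is one-to-one** (`ℤ` is
Hopfian: a surjective endomorphism of a finitely generated module over a commutative ring is
injective, Mathlib's `OrzechProperty.injective_of_surjective_endomorphism`). [folklore] -/
theorem injective_of_surjective_of_mulEquiv_int {A B : Type*} [Group A] [Group B]
    (α : A ≃* Multiplicative ℤ) (β : B ≃* Multiplicative ℤ) (φ : A →* B) (hφ : Surjective φ) :
    Injective φ := by
  -- the conjugate endomorphism of `ℤ`
  let ψ : Multiplicative ℤ →* Multiplicative ℤ := β.toMonoidHom.comp (φ.comp α.symm.toMonoidHom)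
  have hψ : Surjective ψ := β.surjective.comp (hφ.comp α.symm.surjective)
  let ψa : ℤ →+ ℤ := MonoidHom.toAdditive ψ
  have hψa : Surjective ψa := hψ
  have hinj : Injective ψa :=
    OrzechProperty.injective_of_surjective_endomorphism ψa.toIntLinearMap hψa
  have hψinj : Injective ψ := hinj
  intro a a' h
  have : ψ (α a) = ψ (α a') := by
    change β (φ (α.symm (α a))) = β (φ (α.symm (α a')))
    rw [α.symm_apply_apply, α.symm_apply_apply, h]
  exact α.injective (hψinj this)

/-- If a homomorphism from a group `A ≅ ℤ` to a group `B ≅ ℤ` has a generator of `B` (the preimage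
of `1`) in its image, it is onto. [folklore] -/
theorem surjective_of_generator_mem_range {A B : Type*} [Group A] [Group B]
    (β : B ≃* Multiplicative ℤ) (φ : A →* B)
    (h : β.symm (Multiplicative.ofAdd 1) ∈ Set.range φ) : Surjective φ := by
  obtain ⟨a, ha⟩ := h
  intro b
  refine ⟨a ^ (Multiplicative.toAdd (β b)), ?_⟩
  rw [map_zpow, ha]
  apply β.injective
  rw [map_zpow, β.apply_symm_apply]
  change Multiplicative.ofAdd ((Multiplicative.toAdd (β b)) • (1 : ℤ)) = β b
  rw [smul_eq_mul, mul_one]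
  rfl

/-! ### The comparison map -/

variable {K : Type} [TopologicalSpace K] [PathConnectedSpace K] [SimplyConnectedSpace K]

/-- **The `(2N+1)`-connected comparison `ℂPᴺ → K(ℤ, 2)`** (Hatcher 2002, Example 4.50 with §4.3
Thm. 4.58 / Lemma 4.7): let `K` be path connected and simply connected with `π₂(K, k₀) ≅ ℤ` and
`πⱼ(K) = 0` for all `j ≥ 3` (at all base points). Then for every `k` there are a continuous
`c : ℂP¹⁺ᵏ → K` and a base point `x₁` with `c x₁ = k₀` such that `c_*` is onto on `π_{j+1}` for
`j + 1 ≤ 2(1+k) + 1` and one-to-one on `π_{j+1}` for `j + 2 ≤ 2(1+k) + 1`. Construction: realise a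
generator of `π₂(K, k₀)` by `g : S² ≅ ℂP¹ → K`, extend cell by cell over `ℂP¹ ⊂ ⋯ ⊂ ℂP¹⁺ᵏ`
(`π_odd(K) = 0`); on `π₂` the induced homomorphism `ℤ → ℤ` hits a generator, hence is onto, hence
one-to-one; all other relevant groups of source or target vanish.
[cite: HatcherAT2002, Example 4.50 and §4.3 Thm. 4.58] -/
theorem exists_connected_comparison (k₀ : K) (ψ : π_ 2 K k₀ ≃* Multiplicative ℤ)
    (hK : ∀ j : ℕ, 3 ≤ j → ∀ x : K, Subsingleton (π_ j K x)) (k : ℕ) :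
    ∃ (c : C(ComplexProjectiveSpace (1 + k), K)) (x₁ : ComplexProjectiveSpace (1 + k)),
      c x₁ = k₀ ∧
      (∀ j : ℕ, j + 1 ≤ 2 * (1 + k) + 1 → Surjective
        (homotopyGroupMap c x₁ : π_ (j + 1) (ComplexProjectiveSpace (1 + k)) x₁ → π_ (j + 1) K (c x₁))) ∧
      (∀ j : ℕ, j + 2 ≤ 2 * (1 + k) + 1 → Injective
        (homotopyGroupMap c x₁ : π_ (j + 1) (ComplexProjectiveSpace (1 + k)) x₁ → π_ (j + 1) K (c x₁))) := by
  -- realise the generator `γ = ψ⁻¹ 1` by a sphere map `g : S² → K`, `g s = k₀`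
  set γ : π_ 2 K k₀ := ψ.symm (Multiplicative.ofAdd 1) with hγ
  obtain ⟨s, g, hg, hγr⟩ := exists_sphereMap_mem_range (N := 2) γ
  -- `ℂP¹ ≅ S²`
  obtain ⟨D⟩ := nonempty_diffeomorph_complexProjectiveSpace_one_sphere_holds
  let e : ComplexProjectiveSpace 1 ≃ₜ ↥(sphere (0 : EuclideanSpace ℝ (Fin (2 + 1))) 1) := D.toHomeomorph
  let g₁ : C(ComplexProjectiveSpace 1, K) := g.comp (e : C(ComplexProjectiveSpace 1, _))
  -- extend over `ℂP¹⁺ᵏ`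
  have hT : ∀ j, 1 ≤ j → ∀ t : K, Subsingleton (π_ (2 * j + 1) K t) :=
    fun j hj t => hK (2 * j + 1) (by omega) t
  obtain ⟨c, hc⟩ := exists_extension_iterHyperplaneEmb (T := K) (m := 1) hT k g₁
  -- the base point and `c x₁ = k₀`
  let q : C(↥(sphere (0 : EuclideanSpace ℝ (Fin (2 + 1))) 1), ComplexProjectiveSpace (1 + k)) :=
    (iterHyperplaneEmb 1 k).comp (e.symm : C(_, ComplexProjectiveSpace 1))
  set x₁ : ComplexProjectiveSpace (1 + k) := q s with hx₁
  have hcq : c.comp q = g := by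
    ext t
    change c (iterHyperplaneEmb 1 k (e.symm t)) = g t
    rw [hc]
    change g (e (e.symm t)) = g t
    rw [e.apply_symm_apply]
  have hk₀ : k₀ = c x₁ := by
    rw [hg, ← hcq]; rfl
  subst hk₀
  refine ⟨c, x₁, rfl, fun j hj => ?_, fun j hj => ?_⟩
  · -- surjectivity
    rcases Nat.lt_or_ge j 2 with hj2 | hj2
    · interval_cases j
      · -- `π₁(K) = 0`
        haveI : Subsingleton (π_ 1 K (c x₁)) :=
          (HomotopyGroup.pi1EquivFundamentalGroup : π_ 1 K (c x₁) ≃ FundamentalGroup K (c x₁)).subsingleton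
        exact fun b => ⟨default, Subsingleton.elim _ _⟩
      · -- `π₂`: the image contains the generator
        have hrange : Set.range (homotopyGroupMapOfEq (N := Fin 2) g hg) ⊆
            Set.range (homotopyGroupMap (N := Fin 2) c x₁) := by
          rintro _ ⟨a, rfl⟩
          refine ⟨homotopyGroupMapOfEq (N := Fin 2) q rfl a, ?_⟩
          rw [← homotopyGroupMapOfEq_rfl, homotopyGroupMapOfEq_comp]
          exact homotopyGroupMapOfEq_congr hcq _ hg a
        have hsurj : Surjective (homotopyGroupMapHom (N := Fin 2) c x₁) :=
          surjective_of_generator_mem_range ψ (homotopyGroupMapHom (N := Fin 2) c x₁) (hrange hγr)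
        exact hsurj
    · haveI : Subsingleton (π_ (j + 1) K (c x₁)) := hK (j + 1) (by omega) _
      exact fun b => ⟨default, Subsingleton.elim _ _⟩
  · -- injectivity
    rcases Nat.lt_or_ge j 2 with hj2 | hj2
    · interval_cases j
      · -- `π₁(ℂPᴺ) = 0`
        haveI : SimplyConnectedSpace (ComplexProjectiveSpace (1 + k)) :=
          simplyConnectedSpace_complexProjectiveSpace_holds (1 + k)
        haveI : Subsingleton (π_ 1 (ComplexProjectiveSpace (1 + k)) x₁) :=
          (HomotopyGroup.pi1EquivFundamentalGroup :
            π_ 1 (ComplexProjectiveSpace (1 + k)) x₁ ≃ FundamentalGroup _ x₁).subsingleton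
        exact fun a b _ => Subsingleton.elim a b
      · -- `π₂`: an epimorphism `ℤ → ℤ` is one-to-one
        have hrange : Set.range (homotopyGroupMapOfEq (N := Fin 2) g hg) ⊆
            Set.range (homotopyGroupMap (N := Fin 2) c x₁) := by
          rintro _ ⟨a, rfl⟩
          refine ⟨homotopyGroupMapOfEq (N := Fin 2) q rfl a, ?_⟩
          rw [← homotopyGroupMapOfEq_rfl, homotopyGroupMapOfEq_comp]
          exact homotopyGroupMapOfEq_congr hcq _ hg a
        have hsurj : Surjective (homotopyGroupMapHom (N := Fin 2) c x₁) :=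
          surjective_of_generator_mem_range ψ (homotopyGroupMapHom (N := Fin 2) c x₁) (hrange hγr)
        obtain ⟨α⟩ := nonempty_mulEquiv_pi_two_int (n := 1 + k) (by omega) x₁
        exact injective_of_surjective_of_mulEquiv_int α ψ (homotopyGroupMapHom (N := Fin 2) c x₁) hsurj
    · haveI : Subsingleton (π_ (j + 1) (ComplexProjectiveSpace (1 + k)) x₁) :=
        subsingleton_homotopyGroup (n := 1 + k) (by omega) (by omega) x₁
      exact fun a b _ => Subsingleton.elim a b

universe v

omit [PathConnectedSpace K] [SimplyConnectedSpace K] in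
/-- **The cohomology (and homology) of a `K(ℤ, 2)` agrees with that of `ℂPᴺ` up to degree `2N`**
(Hatcher 2002, Example 4.50 with Spanier 1966, Thm. 7.5.9): under the hypotheses of
`exists_connected_comparison` there is `c : ℂP¹⁺ᵏ → K`, `c x₁ = k₀`, with
`c^* : Hⁱ(K; M) → Hⁱ(ℂP¹⁺ᵏ; M)` an isomorphism for `i ≤ 2(1+k)` (`R` a principal ideal domain, `M`
an `R`-module) and `c_* : Hᵢ(ℂP¹⁺ᵏ; R) → Hᵢ(K; R)` an isomorphism for `i ≤ 2(1+k)` (any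
commutative `R`). [cite: HatcherAT2002, Example 4.50] [cite: Spanier1981, Ch. 7 §5 Thm. 9] -/
theorem exists_comparison_isIso_singularCohomology [PathConnectedSpace K] [SimplyConnectedSpace K]
    (k₀ : K) (ψ : π_ 2 K k₀ ≃* Multiplicative ℤ)
    (hK : ∀ j : ℕ, 3 ≤ j → ∀ x : K, Subsingleton (π_ j K x)) (k : ℕ) :
    ∃ (c : C(ComplexProjectiveSpace (1 + k), K)) (x₁ : ComplexProjectiveSpace (1 + k)),
      c x₁ = k₀ ∧
      (∀ (R : Type v) [CommRing R] [IsDomain R] [IsPrincipalIdealRing R]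
        (M : Type v) [AddCommGroup M] [Module R M] (i : ℕ), i ≤ 2 * (1 + k) →
        IsIso (singularCohomology.map R M c i)) ∧
      (∀ (R : Type v) [CommRing R] (i : ℕ), i ≤ 2 * (1 + k) →
        IsIso (singularHomology.map R R c i)) := by
  obtain ⟨c, x₁, hc, hs, hi⟩ := exists_connected_comparison k₀ ψ hK k
  refine ⟨c, x₁, hc, fun R _ _ _ M _ _ i hi' => ?_, fun R _ i hi' => ?_⟩
  · exact ConnectedMap.isIso_singularCohomology_map' c x₁ hs hi R M (by omega)
  · exact ConnectedMap.isIso_singularHomology_map' c x₁ hs hi R (by omega)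

end ComplexProjectiveSpace

end Literature.Topology.FourManifolds

end
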